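import Summits.Ventures.PercRepro.S1CapTenSix

/-!
# PercRepro — THE (P9) CONFIGURATIONS HAVE TEN POINTS (p2, gen 25; SUBCLAIM-S1 §6.9 (xii) T2)

An `e`-free matroid of nullity `6` with `≤ 13` points, `9` triangles and every point on `≥ 2` triangles has
EXACTLY `10` points, at most `4` points of degree `2`, and every point on at most `4` triangles. The lever: for a
point `x` of degree `2` (lines `L₁, L₂`) and a point `y ≠ x` of degree `2` on `L₁`, the set `E ∖ {x, y}` has nullity
`4` (`x ∈ cl (L₂ ∖ x)`, `y` on a triangle avoiding `x`), so it holds `≤ cq3 4 = 5` triangles — but the triangles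
through `x` or `y` are only `L₁`, `L₂` and one more, leaving `6`. Hence every point of a degree-`2` point's lines
has degree `≥ 3`, no triangle holds two degree-`2` points, `2·#D₂ ≤ 9`, and `27 = Σ deg ≥ 3n − #D₂` gives
`n ≤ 10`; `n ≥ 10` as a rank-`≤ 3` ground set holds `≤ 6` points and no triangle.

* `degree_ge_three_of_cone` — the cone points of a degree-`2` point have degree `≥ 3`;
* `ncard_degree_two_le_four` — `#D₂ ≤ 4`;
* **`ncard_eq_ten_of_nine`** — `n = 10`, with the degree multiset facts used by the sum (T5).
Axioms: standard.
-/

open scoped Matroid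

namespace PercRepro

namespace S1

open Set

variable {α : Type}

open Classical in
/-- **The cone points of a degree-`2` point have degree `≥ 3`** (oriented form): `x` lies exactly on the two
triangles `L, L'`; a point `y ∈ L ∖ x` of degree `2` would leave the six triangles avoiding `x` and `y` inside
`E ∖ {x, y}`, of nullity `4`, which holds at most `cq3 4 = 5`. -/
theorem degree_ge_three_of_cone_aux (N : Matroid α) [N.Finite]
    (hfree : ∀ e ∈ N.E, ∃ A ⊆ N.E \ {e}, e ∉ N.closure A ∧ e ∉ N.closure ((N.E \ {e}) \ A))
    (hC1 : ∀ L ⊆ N.E, N.eRk L = 2 → L.ncard ≤ 3)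
    (hd : N.E.encard = N.eRank + ((6 : ℕ) : ℕ∞))
    (h9 : {C : Set α | N.IsCircuit C ∧ C.ncard = 3}.ncard = 9)
    (hdeg : ∀ x ∈ N.E, 2 ≤ {C : Set α | N.IsCircuit C ∧ C.ncard = 3 ∧ x ∈ C}.ncard)
    {x : α} {L L' : Set α} (hL : L ∈ ThmN.trianglesThrough N x) (hL' : L' ∈ ThmN.trianglesThrough N x)
    (hne : L ≠ L') (hall : ∀ C ∈ ThmN.trianglesThrough N x, C = L ∨ C = L')
    {y : α} (hy : y ∈ L) (hyx : y ≠ x) :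
    3 ≤ {C : Set α | N.IsCircuit C ∧ C.ncard = 3 ∧ y ∈ C}.ncard := by
  have hEfin : N.E.Finite := N.ground_finite
  have hxE : x ∈ N.E := hL.1.subset_ground hL.2.2
  have hyE : y ∈ N.E := hL.1.subset_ground hy
  have hyL' : y ∉ L' := by
    intro hyL'
    have hint := ThmN.inter_eq_singleton_of_mem_trianglesThrough N hC1 hL hL' hne
    have : y ∈ L ∩ L' := ⟨hy, hyL'⟩
    rw [hint] at this
    exact hyx this
  by_contra hlt
  push Not at hlt
  have hy2 : {C : Set α | N.IsCircuit C ∧ C.ncard = 3 ∧ y ∈ C}.ncard = 2 := by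
    have := hdeg y hyE; omega
  -- the two triangles through `y`: `L` and one more, `T'`, which avoids `x`
  obtain ⟨M₁, M₂, hM12, hMeq⟩ := Set.ncard_eq_two.1 hy2
  have hmemy : ∀ C, C ∈ ThmN.trianglesThrough N y ↔ C = M₁ ∨ C = M₂ := by
    intro C
    have : C ∈ ThmN.trianglesThrough N y ↔ C ∈ ({M₁, M₂} : Set (Set α)) := by rw [← hMeq]; rfl
    rw [this]; simp
  have hLy : L ∈ ThmN.trianglesThrough N y := ⟨hL.1, hL.2.1, hy⟩
  obtain ⟨T', hT', hLT'⟩ : ∃ T', T' ∈ ThmN.trianglesThrough N y ∧ L ≠ T' := by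
    rcases (hmemy L).1 hLy with rfl | rfl
    · exact ⟨M₂, (hmemy M₂).2 (Or.inr rfl), hM12⟩
    · exact ⟨M₁, (hmemy M₁).2 (Or.inl rfl), Ne.symm hM12⟩
  have hally : ∀ C ∈ ThmN.trianglesThrough N y, C = L ∨ C = T' := by
    intro C hC
    rcases (hmemy C).1 hC with rfl | rfl
    · rcases (hmemy L).1 hLy with h | h
      · exact Or.inl h.symm
      · rcases (hmemy T').1 hT' with h' | h'
        · exact Or.inr h'.symm
        · exact absurd (h.trans h'.symm) hLT'
    · rcases (hmemy L).1 hLy with h | h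
      · rcases (hmemy T').1 hT' with h' | h'
        · exact absurd (h.trans h'.symm) hLT'
        · exact Or.inr h'.symm
      · exact Or.inl h.symm
  have hxT' : x ∉ T' := by
    intro hxT'
    rcases hall T' ⟨hT'.1, hT'.2.1, hxT'⟩ with rfl | rfl
    · exact hLT' rfl
    · exact hyL' hT'.2.2
  -- the triangles avoiding `x` and `y`: at least `6`, inside `E ∖ {x, y}` of nullity `4`
  have hmem𝒯 : ∀ C, C ∈ (finite_triangles N).toFinset ↔ N.IsCircuit C ∧ C.ncard = 3 := fun C => by
    rw [Set.Finite.mem_toFinset]; rfl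
  have h𝒯card : (finite_triangles N).toFinset.card = 9 := by
    rw [← h9]; exact (Set.ncard_eq_toFinset_card _ (finite_triangles N)).symm
  obtain ⟨hS''E, hZS'', hcov'', hsub'', heq''⟩ :=
    triangle_union_facts N {x, y}
      (⋃ C ∈ (finite_triangles N).toFinset.filter (fun C => ∀ z ∈ ({x, y} : Set α), z ∉ C), C) rfl
  set S'' := ⋃ C ∈ (finite_triangles N).toFinset.filter (fun C => ∀ z ∈ ({x, y} : Set α), z ∉ C), C with hS''def
  have hxS'' : x ∉ S'' := hZS'' x (by simp)
  have hyS'' : y ∉ S'' := hZS'' y (by simp)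
  have hS''tri : 6 ≤ {C : Set α | N.IsCircuit C ∧ C.ncard = 3 ∧ C ⊆ S''}.ncard := by
    rw [heq'', Set.ncard_coe_finset]
    have hcards := Finset.card_filter_add_card_filter_not (s := (finite_triangles N).toFinset)
      (fun C => ∀ z ∈ ({x, y} : Set α), z ∉ C)
    have hle : ((finite_triangles N).toFinset.filter
        (fun C => ¬ ∀ z ∈ ({x, y} : Set α), z ∉ C)).card ≤ 3 := by
      have hsub : (finite_triangles N).toFinset.filter (fun C => ¬ ∀ z ∈ ({x, y} : Set α), z ∉ C) ⊆ {L, L', T'} := by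
        intro C hC
        obtain ⟨hC𝒯, hnot⟩ := Finset.mem_filter.1 hC
        have hC3 := (hmem𝒯 C).1 hC𝒯
        simp only [Finset.mem_insert, Finset.mem_singleton]
        by_contra hne'
        push Not at hne'
        apply hnot
        intro z hz hzC
        rcases hz with rfl | rfl
        · rcases hall C ⟨hC3.1, hC3.2, hzC⟩ with h | h
          · exact hne'.1 h
          · exact hne'.2.1 h
        · rcases hally C ⟨hC3.1, hC3.2, hzC⟩ with h | h
          · exact hne'.1 h
          · exact hne'.2.2 h
      exact (Finset.card_le_card hsub).trans (Finset.card_le_three)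
    omega
  obtain ⟨ν'', hν''⟩ := exists_nullity N hS''E
  have hX : (N.E \ {x, y}).encard = N.eRk (N.E \ {x, y}) + ((6 - 2 : ℕ) : ℕ∞) := by
    refine nullity_of_subset_closure N sdiff_subset subset_rfl ?_ (by rwa [N.eRk_ground]) ?_
    · intro z hz
      by_cases hzx : z = x
      · rw [hzx]
        refine N.closure_subset_closure ?_ (hL'.1.mem_closure_sdiff_singleton_of_mem hL'.2.2)
        intro w hw
        refine ⟨hL'.1.subset_ground hw.1, ?_⟩
        intro hw'
        rcases hw' with rfl | rfl
        · exact hw.2 rfl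
        · exact hyL' hw.1
      by_cases hzy : z = y
      · rw [hzy]
        refine N.closure_subset_closure ?_ (hT'.1.mem_closure_sdiff_singleton_of_mem hT'.2.2)
        intro w hw
        refine ⟨hT'.1.subset_ground hw.1, ?_⟩
        intro hw'
        rcases hw' with rfl | rfl
        · exact hxT' hw.1
        · exact hw.2 rfl
      · exact N.subset_closure _ sdiff_subset ⟨hz, by simp [hzx, hzy]⟩
    · rw [Set.sdiff_sdiff_cancel_left (by intro z hz; rcases hz with rfl | rfl <;> assumption),
        Set.encard_pair (Ne.symm hyx)]
      rfl
  have hν''le : ν'' ≤ 6 - 2 :=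
    nullity_le_of_subset N (T := N.E \ {x, y}) (fun z hz => ⟨hS''E hz, fun h => by
      rcases h with rfl | rfl
      · exact hxS'' hz
      · exact hyS'' hz⟩) sdiff_subset hν'' hX
  have htri_le'' := ncard_triangles_subset_le_cq3 N hfree hS''E hν''
  have hcq : TriangleCap.cq3 ν'' ≤ 5 := by
    have : ν'' ≤ 4 := by omega
    interval_cases ν'' <;> decide
  omega

open Classical in
/-- **THE (P9) CONFIGURATIONS HAVE TEN POINTS**: an `e`-free matroid of nullity `6` with `≤ 13` points, `9`
triangles and every point on `≥ 2` triangles has exactly `10` points, at most `4` points of degree `2`, and every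
point on at most `4` triangles. -/
theorem ncard_eq_ten_of_nine (N : Matroid α) [N.Finite]
    (hfree : ∀ e ∈ N.E, ∃ A ⊆ N.E \ {e}, e ∉ N.closure A ∧ e ∉ N.closure ((N.E \ {e}) \ A))
    (hd : N.E.encard = N.eRank + ((6 : ℕ) : ℕ∞)) (hn : N.E.ncard ≤ 13)
    (h9 : {C : Set α | N.IsCircuit C ∧ C.ncard = 3}.ncard = 9)
    (hdeg : ∀ x ∈ N.E, 2 ≤ {C : Set α | N.IsCircuit C ∧ C.ncard = 3 ∧ x ∈ C}.ncard) :
    N.E.ncard = 10 ∧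
      (N.ground_finite.toFinset.filter
        (fun x => {C : Set α | N.IsCircuit C ∧ C.ncard = 3 ∧ x ∈ C}.ncard = 2)).card ≤ 4 ∧
      (∀ x ∈ N.E, {C : Set α | N.IsCircuit C ∧ C.ncard = 3 ∧ x ∈ C}.ncard ≤ 4) := by
  have hEfin : N.E.Finite := N.ground_finite
  have hL : ∀ e ∈ N.E, ¬ N.IsLoop e := ThmN.not_isLoop_of_free N hfree
  have hC1 : ∀ L ⊆ N.E, N.eRk L = 2 → L.ncard ≤ 3 := by
    intro L hL' hr
    have := ThmN.ncard_add_one_le_two_pow_of_eRk_le N hL hfree 2 L hL' hr.le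
    omega
  have hC2 : ∀ P ⊆ N.E, N.eRk P ≤ 3 → P.ncard ≤ 6 := fun P hP hr =>
    ThmN.ncard_le_six_of_eRk_le_three_of_free N hfree hP hr
  -- the finsets
  have hmem𝒯 : ∀ C, C ∈ (finite_triangles N).toFinset ↔ N.IsCircuit C ∧ C.ncard = 3 := fun C => by
    rw [Set.Finite.mem_toFinset]; rfl
  have h𝒯card : (finite_triangles N).toFinset.card = 9 := by
    rw [← h9]; exact (Set.ncard_eq_toFinset_card _ (finite_triangles N)).symm
  have hmemE : ∀ x, x ∈ hEfin.toFinset ↔ x ∈ N.E := fun x => Set.Finite.mem_toFinset _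
  have hEcard : hEfin.toFinset.card = N.E.ncard := (Set.ncard_eq_toFinset_card _ hEfin).symm
  have hdegset : ∀ x, ((finite_triangles N).toFinset.filter (fun C => x ∈ C)).card =
      {C : Set α | N.IsCircuit C ∧ C.ncard = 3 ∧ x ∈ C}.ncard := by
    intro x
    rw [← Set.ncard_coe_finset]
    congr 1
    ext C
    simp only [Finset.coe_filter, hmem𝒯, Set.mem_setOf_eq]
    tauto
  have hsum3 : ∑ x ∈ hEfin.toFinset, ((finite_triangles N).toFinset.filter (fun C => x ∈ C)).card = 27 := by
    rw [sum_card_filter_mem N _ 3 (fun C hC => ⟨((hmem𝒯 C).1 hC).1.subset_ground, ((hmem𝒯 C).1 hC).2⟩), h𝒯card]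
  -- `n ≥ 10`
  have hn10 : 10 ≤ N.E.ncard := by
    obtain ⟨T, hT⟩ : ∃ T, T ∈ (finite_triangles N).toFinset := by
      by_contra h
      push Not at h
      have : (finite_triangles N).toFinset = ∅ := Finset.eq_empty_of_forall_notMem h
      rw [this, Finset.card_empty] at h𝒯card
      omega
    have hT3 := (hmem𝒯 T).1 hT
    have hTr : N.eRk T = 2 := by
      have h := hT3.1.eRk_add_one_eq
      rw [← (hEfin.subset hT3.1.subset_ground).cast_ncard_eq, hT3.2] at h
      have hfin : N.eRk T ≠ ⊤ := ((N.eRk_le_encard T).trans_lt (hEfin.subset hT3.1.subset_ground).encard_lt_top).ne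
      obtain ⟨r, hr⟩ := ENat.ne_top_iff_exists.1 hfin
      rw [← hr] at h ⊢
      have : r + 1 = 3 := by exact_mod_cast h
      norm_cast; omega
    obtain ⟨r, hr⟩ := ENat.ne_top_iff_exists.1 ((N.eRk_le_encard N.E).trans_lt hEfin.encard_lt_top).ne
    have hd' : N.E.ncard = r + 6 := by
      have h := hd
      rw [N.eRank_def, ← hr, ← hEfin.cast_ncard_eq] at h
      exact_mod_cast h
    by_contra hlt
    have hr3 : r ≤ 3 := by omega
    have hE6 : N.E.ncard ≤ 6 := hC2 N.E subset_rfl (by rw [← hr]; exact_mod_cast hr3)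
    have hr0 : r = 0 := by omega
    have hle : N.eRk T ≤ N.eRk N.E := N.eRk_mono hT3.1.subset_ground
    rw [hTr, ← hr, hr0] at hle
    exact absurd hle (by decide)
  -- the degree-`2` points: no triangle holds two of them
  set D₂ := hEfin.toFinset.filter (fun x => {C : Set α | N.IsCircuit C ∧ C.ncard = 3 ∧ x ∈ C}.ncard = 2) with hD₂
  have hcone : ∀ x ∈ D₂, ∀ C ∈ ThmN.trianglesThrough N x, ∀ y ∈ C, y ≠ x →
      3 ≤ {C : Set α | N.IsCircuit C ∧ C.ncard = 3 ∧ y ∈ C}.ncard := by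
    intro x hx C hC y hy hyx
    obtain ⟨hxE, hx2⟩ := Finset.mem_filter.1 hx
    obtain ⟨L₁, L₂, h12, hLeq⟩ := Set.ncard_eq_two.1 hx2
    have hmemx : ∀ C, C ∈ ThmN.trianglesThrough N x ↔ C = L₁ ∨ C = L₂ := by
      intro C
      have : C ∈ ThmN.trianglesThrough N x ↔ C ∈ ({L₁, L₂} : Set (Set α)) := by rw [← hLeq]; rfl
      rw [this]; simp
    have hL₁ : L₁ ∈ ThmN.trianglesThrough N x := (hmemx L₁).2 (Or.inl rfl)
    have hL₂ : L₂ ∈ ThmN.trianglesThrough N x := (hmemx L₂).2 (Or.inr rfl)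
    rcases (hmemx C).1 hC with rfl | rfl
    · exact degree_ge_three_of_cone_aux N hfree hC1 hd h9 hdeg hL₁ hL₂ h12 (fun C hC => (hmemx C).1 hC) hy hyx
    · exact degree_ge_three_of_cone_aux N hfree hC1 hd h9 hdeg hL₂ hL₁ (Ne.symm h12)
        (fun C hC => ((hmemx C).1 hC).symm) hy hyx
  have hone : ∀ T ∈ (finite_triangles N).toFinset, (D₂.filter (fun x => x ∈ T)).card ≤ 1 := by
    intro T hT
    rw [Finset.card_le_one]
    intro x hx x' hx'
    obtain ⟨hxD, hxT⟩ := Finset.mem_filter.1 hx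
    obtain ⟨hx'D, hx'T⟩ := Finset.mem_filter.1 hx'
    by_contra hne
    have hT3 := (hmem𝒯 T).1 hT
    have := hcone x hxD T ⟨hT3.1, hT3.2, hxT⟩ x' hx'T (fun h => hne h.symm)
    have h2 := (Finset.mem_filter.1 hx'D).2
    omega
  -- `2·#D₂ ≤ 9` by double counting the incidences
  have hinc : ∑ x ∈ D₂, ((finite_triangles N).toFinset.filter (fun C => x ∈ C)).card ≤ 9 := by
    calc ∑ x ∈ D₂, ((finite_triangles N).toFinset.filter (fun C => x ∈ C)).card
        = ∑ x ∈ D₂, ∑ C ∈ (finite_triangles N).toFinset, (if x ∈ C then 1 else 0) := by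
          apply Finset.sum_congr rfl; intro x _; rw [Finset.card_filter]
      _ = ∑ C ∈ (finite_triangles N).toFinset, ∑ x ∈ D₂, (if x ∈ C then 1 else 0) := Finset.sum_comm
      _ = ∑ C ∈ (finite_triangles N).toFinset, (D₂.filter (fun x => x ∈ C)).card := by
          apply Finset.sum_congr rfl; intro C _; rw [Finset.card_filter]
      _ ≤ ∑ _C ∈ (finite_triangles N).toFinset, 1 := Finset.sum_le_sum (fun C hC => hone C hC)
      _ = 9 := by rw [Finset.sum_const, smul_eq_mul, mul_one, h𝒯card]
  have hD₂sum : ∑ x ∈ D₂, ((finite_triangles N).toFinset.filter (fun C => x ∈ C)).card = 2 * D₂.card := by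
    have h2 : ∀ x ∈ D₂, ((finite_triangles N).toFinset.filter (fun C => x ∈ C)).card = 2 := by
      intro x hx
      rw [hdegset]
      exact (Finset.mem_filter.1 hx).2
    rw [Finset.sum_congr rfl h2, Finset.sum_const, smul_eq_mul, mul_comm]
  have hD₂4 : D₂.card ≤ 4 := by omega
  -- the degree sum: `27 ≥ 2·#D₂ + 3·(n − #D₂)`
  have hsplit := Finset.sum_filter_add_sum_filter_not hEfin.toFinset
    (fun x => {C : Set α | N.IsCircuit C ∧ C.ncard = 3 ∧ x ∈ C}.ncard = 2)
    (fun x => ((finite_triangles N).toFinset.filter (fun C => x ∈ C)).card)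
  rw [hsum3] at hsplit
  have hrest : (hEfin.toFinset.filter
      (fun x => ¬ {C : Set α | N.IsCircuit C ∧ C.ncard = 3 ∧ x ∈ C}.ncard = 2)).card • 3 ≤
      ∑ x ∈ hEfin.toFinset.filter (fun x => ¬ {C : Set α | N.IsCircuit C ∧ C.ncard = 3 ∧ x ∈ C}.ncard = 2),
        ((finite_triangles N).toFinset.filter (fun C => x ∈ C)).card := by
    apply Finset.card_nsmul_le_sum
    intro x hx
    obtain ⟨hxE, hx2⟩ := Finset.mem_filter.1 hx
    rw [hdegset]
    have := hdeg x ((hmemE x).1 hxE)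
    omega
  have hcards := Finset.card_filter_add_card_filter_not (s := hEfin.toFinset)
    (fun x => {C : Set α | N.IsCircuit C ∧ C.ncard = 3 ∧ x ∈ C}.ncard = 2)
  rw [hEcard] at hcards
  rw [smul_eq_mul] at hrest
  rw [← hD₂] at hsplit hcards
  have hn10' : N.E.ncard = 10 := by omega
  refine ⟨hn10', hD₂4, ?_⟩
  -- every degree is at most `4`
  intro x hx
  by_contra hgt
  push Not at hgt
  have hsplitx := Finset.add_sum_erase hEfin.toFinset
    (fun y => ((finite_triangles N).toFinset.filter (fun C => y ∈ C)).card) ((hmemE x).2 hx)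
  rw [hsum3, hdegset] at hsplitx
  -- the other `9` points: `#D₂` of degree `2` (all of `D₂`, as `x ∉ D₂`), the rest `≥ 3`
  have hxD : x ∉ D₂ := fun h => by have := (Finset.mem_filter.1 h).2; omega
  have hsplit' := Finset.sum_filter_add_sum_filter_not (hEfin.toFinset.erase x)
    (fun y => {C : Set α | N.IsCircuit C ∧ C.ncard = 3 ∧ y ∈ C}.ncard = 2)
    (fun y => ((finite_triangles N).toFinset.filter (fun C => y ∈ C)).card)
  have hfilt : (hEfin.toFinset.erase x).filter
      (fun y => {C : Set α | N.IsCircuit C ∧ C.ncard = 3 ∧ y ∈ C}.ncard = 2) = D₂ := by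
    rw [hD₂, Finset.filter_erase, Finset.erase_eq_of_notMem]
    rw [← hD₂]; exact hxD
  rw [hfilt, hD₂sum] at hsplit'
  have hrest' : ((hEfin.toFinset.erase x).filter
      (fun y => ¬ {C : Set α | N.IsCircuit C ∧ C.ncard = 3 ∧ y ∈ C}.ncard = 2)).card • 3 ≤
      ∑ y ∈ (hEfin.toFinset.erase x).filter (fun y => ¬ {C : Set α | N.IsCircuit C ∧ C.ncard = 3 ∧ y ∈ C}.ncard = 2),
        ((finite_triangles N).toFinset.filter (fun C => y ∈ C)).card := by
    apply Finset.card_nsmul_le_sum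
    intro y hy
    obtain ⟨hyE, hy2⟩ := Finset.mem_filter.1 hy
    rw [hdegset]
    have := hdeg y ((hmemE y).1 (Finset.mem_of_mem_erase hyE))
    omega
  have hcards' := Finset.card_filter_add_card_filter_not (s := hEfin.toFinset.erase x)
    (fun y => {C : Set α | N.IsCircuit C ∧ C.ncard = 3 ∧ y ∈ C}.ncard = 2)
  rw [hfilt, Finset.card_erase_of_mem ((hmemE x).2 hx), hEcard, hn10'] at hcards'
  rw [smul_eq_mul] at hrest'
  omega

end S1

end PercRepro
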